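import Literature.Barriers.ABC.BakerMethodBoundsBakerWustholzProofs

/-!
# Stub `stub_fibreBaker` of line `Sketch` — crux `IneffectiveSubspace.DepthCountedABC` (stmt-ABC-14938)

THE BAKER STRATUM OF THE T CORE.  Line `Sketch`'s T-core asks for `c < C·(a·rad(bc))^(1+δ)` on the
cell `ω₅(abc) ≤ K` (member `a` at full size).  On the COEFFICIENT FIBRES `{rad(bc) ≤ R}` — the primes
of `b` and `c` confined to a bounded set, their exponents free, at every depth (e.g. `(a, 3^m·5, 2^n·7)`)
— the statement holds in the strong form `c ≤ C(R, δ)·a^(1+δ)`, conditionally on the theorem of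
Baker–Wüstholz on linear forms in logarithms, kept in the tree as the cited named fact
`Literature.NumberTheory.DiophantineGeometry.baker_wustholz ℚ` (classical instance:
`|2ⁿ·7 − 3ᵐ·5| ≫_δ (2ⁿ)^(1−δ)`).  This file proves that implication; it does NOT prove the named fact,
which enters as the hypothesis of `stub_fibreBaker`.

**Proof.**  Let `(a, b, c)` be an abc triple with `rad(bc) ≤ R`.  Then `c, b` are coprime, `cb ≥ 2`,
and the tree's consequence of Baker–Wüstholz on Pasten's splitting of `c/b` at threshold `N = 0`
(`Literature.Barriers.ABC.neg_log_abs_one_sub_div_le_of_bakerWustholz`; at `N = 0` every prime of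
`cb` is "big" and the cofactor `ξ₀` has height `0`) reads
`log b − log a = −log |1 − c/b| ≤ 1 + C(#I+1, 1)·max(h(ξ₀), 1)·∏_{p ∈ I} max(log p, 1)·(1 + log(log(cb)/log 2))`.
UNIFORMITY ON THE FIBRE (`fibreBaker_coeff_bound`): every `p ∣ cb` divides `rad(bc) ≤ R`, so
`I ⊆ {0, …, R}`, `#I + 1 ≤ R + 2` and `C(#I+1, 1) ≤ C(R+2, 1)` (`bwConstant_mul_pow_le`, monotonicity
in `n` at `d = 1`); `h(ξ₀) ≤ 0 · log rad(cb) = 0` (`Pasten.logHeight₁_cofactor_le`); and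
`∏_{p ∈ I} max(log p, 1) ≤ max(log R, 1)^(R+1)`.  Hence
`log b − log a ≤ 1 + K_R · (1 + log(log(cb)/log 2))` with `K_R = C(R+2, 1) · max(log R, 1)^(R+1)`.
ABSORPTION (`fibreBaker_absorb`, pure real analysis, for any `K ≥ 0`): `b ≤ c` gives
`log(cb)/log 2 ≤ t := 2 log c / log 2`, so exponentiating, `b ≤ a · e^{1+K} · t^K`;
`log c ≤ c^ε/ε` (`Real.log_le_rpow_div`) with `ε = η/(K+1)` gives `t^K ≤ A · c^η`
(`fibreBaker_logpow_le`), whence `c = a + b ≤ (1 + e^{1+K} A) · a · c^η`, i.e. `c^{1−η} ≤ M₁ a`, and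
with `η = δ/(1+δ)` (so that `1 − η = 1/(1+δ)`) finally `c ≤ M₁^{1+δ} · a^{1+δ}`.

Sources: skeleton `Cruxes/DepthCountedABC/Lines/Sketch.lean` of lead `prover-line-stmt-ABC-14938-0`
(stub `stub_fibreBaker`).  Ingredients: the NAMED FACT `baker_wustholz ℚ` (hypothesis; Baker–Wüstholz,
J. reine angew. Math. 442 (1993), Theorem = Baker–Wüstholz 2007, Thm 7.1; unproved in the tree, cited
in `Literature/NumberTheory/DiophantineGeometry/AbcWave0.lean`); PROVED in the tree:
`Literature.Barriers.ABC.neg_log_abs_one_sub_div_le_of_bakerWustholz`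
(`Literature/Barriers/ABC/BakerMethodBoundsBakerWustholzProofs.lean`), `Pasten.bigPrimes_subset`,
`Pasten.prime_of_mem_bigPrimes`, `Pasten.logHeight₁_cofactor_le`
(`Literature/NumberTheory/DiophantineGeometry/PastenSubexpDecomposition.lean`), `bwConstant_pos`,
`bwConstant_mul_pow_le` (`Literature/NumberTheory/DiophantineGeometry/AbcWave0BakerWustholzProofs.lean`);
Mathlib: `Nat.primeFactors_radical`, `Nat.le_of_mem_primeFactors`, `Real.log_le_rpow_div`,
`Real.rpow_def_of_pos`, `Real.rpow_sub`, `Real.rpow_mul`, `Real.mul_rpow`, `Real.rpow_le_rpow`,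
`Real.rpow_le_rpow_of_exponent_le`, `Finset.prod_le_prod`, `pow_le_pow_right₀`.
Deliberately NOT here: any uniformity in `R` (that is the open T core itself), the named fact, and the
bookkeeping of the explicit value of `C(R, δ)` (visible in the proof, not recorded in the statement).
-/

-- `Summit.<Summit>.<Problem>` is the mandated summit-side namespace (CONVENTIONS §2); for the
-- single-conjunct summit `ABC` the two coincide, so the duplicate `ABC.ABC` is deliberate.
set_option linter.dupNamespace false

namespace Summit.ABC.ABC.Theorems.DepthCountedABC

open scoped BigOperators
open Height
open Literature.NumberTheory.DiophantineGeometry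
open Literature.NumberTheory.DiophantineGeometry.Pasten

/-! ### Real analysis: absorbing a power of `log c` into `c^η` -/

/-- **A power of `log c` is absorbed by any power of `c`.**  For `K ≥ 0` and `η > 0` there is `A > 0`
with `(2 log c / log 2)^K ≤ A · c^η` for all real `c ≥ 1`: from `log c ≤ c^ε/ε`
(`Real.log_le_rpow_div`) with `ε = η/(K+1)`, `A = (2/(ε log 2))^K`. -/
theorem fibreBaker_logpow_le {K η : ℝ} (hK : 0 ≤ K) (hη : 0 < η) :
    ∃ A : ℝ, 0 < A ∧ ∀ c : ℝ, 1 ≤ c → (2 * Real.log c / Real.log 2) ^ K ≤ A * c ^ η := by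
  have hlog2 : 0 < Real.log 2 := Real.log_pos (by norm_num)
  have hK1 : 0 < K + 1 := by linarith
  set ε : ℝ := η / (K + 1) with hε
  have hε0 : 0 < ε := div_pos hη hK1
  have hεK : ε * K ≤ η := by
    have h1 : ε * (K + 1) = η := by rw [hε]; field_simp
    nlinarith
  set D : ℝ := 2 / ε / Real.log 2 with hD
  have hD0 : 0 < D := div_pos (div_pos two_pos hε0) hlog2
  refine ⟨D ^ K, Real.rpow_pos_of_pos hD0 K, fun c hc => ?_⟩
  have hc0 : 0 ≤ c := zero_le_one.trans hc
  have hlogc : 0 ≤ Real.log c := Real.log_nonneg hc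
  have ht0 : 0 ≤ 2 * Real.log c / Real.log 2 :=
    div_nonneg (mul_nonneg zero_le_two hlogc) hlog2.le
  have h1 : Real.log c ≤ c ^ ε / ε := Real.log_le_rpow_div hc0 hε0
  have h2 : 2 * Real.log c / Real.log 2 ≤ D * c ^ ε := by
    calc 2 * Real.log c / Real.log 2 ≤ 2 * (c ^ ε / ε) / Real.log 2 :=
          div_le_div_of_nonneg_right (mul_le_mul_of_nonneg_left h1 zero_le_two) hlog2.le
      _ = D * c ^ ε := by rw [hD]; ring
  calc (2 * Real.log c / Real.log 2) ^ K ≤ (D * c ^ ε) ^ K := Real.rpow_le_rpow ht0 h2 hK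
    _ = D ^ K * c ^ (ε * K) := by
        rw [Real.mul_rpow hD0.le (Real.rpow_nonneg hc0 _), Real.rpow_mul hc0]
    _ ≤ D ^ K * c ^ η :=
        mul_le_mul_of_nonneg_left (Real.rpow_le_rpow_of_exponent_le hc hεK)
          (Real.rpow_nonneg hD0.le _)

/-- **Absorption step** (pure real analysis).  For `K ≥ 0` and `δ > 0` there is `M > 0` such that
for all real `a, b ≥ 1` with `a + b = c`: if `log b − log a ≤ 1 + K · (1 + log(log(cb)/log 2))`
(the shape of the Baker–Wüstholz lower bound for the linear form `log(c/b)`), then `c ≤ M · a^(1+δ)`.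
Proof: `log(cb)/log 2 ≤ t = 2 log c/log 2`, so `b ≤ a e^{1+K} t^K ≤ a e^{1+K} A c^η`
(`fibreBaker_logpow_le`, `η = δ/(1+δ)`), `c = a + b ≤ (1 + e^{1+K} A) a c^η`, and
`c = (c^{1−η})^{1+δ} ≤ ((1 + e^{1+K} A) a)^{1+δ}`. -/
theorem fibreBaker_absorb {K δ : ℝ} (hK : 0 ≤ K) (hδ : 0 < δ) :
    ∃ M : ℝ, 0 < M ∧ ∀ a b c : ℝ, 1 ≤ a → 1 ≤ b → a + b = c →
      Real.log b - Real.log a ≤ 1 + K * (1 + Real.log (Real.log (c * b) / Real.log 2)) →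
      c ≤ M * a ^ (1 + δ) := by
  have hlog2 : 0 < Real.log 2 := Real.log_pos (by norm_num)
  have hδ1 : 0 < 1 + δ := by linarith
  set η : ℝ := δ / (1 + δ) with hη
  have hη0 : 0 < η := div_pos hδ hδ1
  have hη1 : 1 - η = 1 / (1 + δ) := by rw [hη]; field_simp; ring
  obtain ⟨A, hA, hAc⟩ := fibreBaker_logpow_le hK hη0
  set M₁ : ℝ := Real.exp (1 + K) * A with hM₁
  have hM₁0 : 0 < M₁ := mul_pos (Real.exp_pos _) hA
  refine ⟨(1 + M₁) ^ (1 + δ), Real.rpow_pos_of_pos (by linarith) _,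
    fun a b c ha hb habc hlog => ?_⟩
  have ha0 : 0 < a := by linarith
  have hb0 : 0 < b := by linarith
  have hc1 : 1 ≤ c := by linarith
  have hc0 : 0 < c := by linarith
  have hbc : b ≤ c := by linarith
  -- `1 ≤ log(cb)/log 2 ≤ t := 2 log c / log 2`
  have hcb2 : (2 : ℝ) ≤ c * b := by nlinarith
  have hQ1 : 1 ≤ Real.log (c * b) / Real.log 2 := by
    rw [le_div_iff₀ hlog2, one_mul]; exact Real.log_le_log two_pos hcb2
  have hQ0 : 0 < Real.log (c * b) / Real.log 2 := lt_of_lt_of_le one_pos hQ1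
  have hQ : Real.log (c * b) / Real.log 2 ≤ 2 * Real.log c / Real.log 2 := by
    refine div_le_div_of_nonneg_right ?_ hlog2.le
    rw [Real.log_mul hc0.ne' hb0.ne']
    have : Real.log b ≤ Real.log c := Real.log_le_log hb0 hbc
    linarith
  set t : ℝ := 2 * Real.log c / Real.log 2 with ht
  have ht0 : 0 < t := lt_of_lt_of_le hQ0 hQ
  have hlogQ : Real.log (Real.log (c * b) / Real.log 2) ≤ Real.log t := Real.log_le_log hQ0 hQ
  -- `log b - log a ≤ (1 + K) + K log t`
  have h1 : Real.log b - Real.log a ≤ (1 + K) + K * Real.log t := by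
    have := mul_le_mul_of_nonneg_left hlogQ hK
    linarith
  -- exponentiate: `b ≤ a · (e^{1+K} · t^K)`
  have h2 : b ≤ a * (Real.exp (1 + K) * t ^ K) := by
    have h2a : Real.exp (Real.log b - Real.log a) ≤ Real.exp ((1 + K) + K * Real.log t) :=
      Real.exp_le_exp.mpr h1
    rw [Real.exp_sub, Real.exp_log hb0, Real.exp_log ha0, Real.exp_add, div_le_iff₀ ha0] at h2a
    rw [Real.rpow_def_of_pos ht0, mul_comm (Real.log t) K]
    linarith
  -- absorb: `t^K ≤ A c^η`, so `b ≤ M₁ a c^η` and `c ≤ (1 + M₁) a c^η`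
  have h3 : b ≤ M₁ * a * c ^ η := by
    have hAK := hAc c hc1
    calc b ≤ a * (Real.exp (1 + K) * t ^ K) := h2
      _ ≤ a * (Real.exp (1 + K) * (A * c ^ η)) :=
          mul_le_mul_of_nonneg_left (mul_le_mul_of_nonneg_left hAK (Real.exp_pos _).le) ha0.le
      _ = M₁ * a * c ^ η := by rw [hM₁]; ring
  have hcη : 1 ≤ c ^ η := Real.one_le_rpow hc1 hη0.le
  have h4 : c ≤ (1 + M₁) * a * c ^ η := by
    have haη : a ≤ a * c ^ η := le_mul_of_one_le_right ha0.le hcη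
    calc c = a + b := habc.symm
      _ ≤ a * c ^ η + M₁ * a * c ^ η := add_le_add haη h3
      _ = (1 + M₁) * a * c ^ η := by ring
  -- extract: `c^{1-η} ≤ (1 + M₁) a` with `1 - η = 1/(1+δ)`, then raise to the power `1 + δ`
  have h5 : c ^ (1 / (1 + δ)) ≤ (1 + M₁) * a := by
    rw [← hη1, Real.rpow_sub hc0, Real.rpow_one, div_le_iff₀ (Real.rpow_pos_of_pos hc0 η)]
    exact h4
  have h6 : c = (c ^ (1 / (1 + δ))) ^ (1 + δ) := by
    rw [← Real.rpow_mul hc0.le, one_div_mul_cancel hδ1.ne', Real.rpow_one]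
  calc c = (c ^ (1 / (1 + δ))) ^ (1 + δ) := h6
    _ ≤ ((1 + M₁) * a) ^ (1 + δ) := Real.rpow_le_rpow (Real.rpow_nonneg hc0.le _) h5 hδ1.le
    _ = (1 + M₁) ^ (1 + δ) * a ^ (1 + δ) := Real.mul_rpow (by linarith) ha0.le

/-! ### Arithmetic: the Baker–Wüstholz coefficient is bounded on the fibre `rad(bc) ≤ R` -/

/-- On the fibre `rad(bc) ≤ R` every prime of `cb` is at most `R`
(`(rad n).primeFactors = n.primeFactors`, `Nat.primeFactors_radical`). -/
theorem fibreBaker_primeFactors_subset {b c R : ℕ}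
    (hR : UniqueFactorizationMonoid.radical (b * c) ≤ R) :
    (c * b).primeFactors ⊆ Finset.range (R + 1) := by
  intro p hp
  rw [mul_comm, ← Nat.primeFactors_radical] at hp
  exact Finset.mem_range.mpr (Nat.lt_succ_of_le ((Nat.le_of_mem_primeFactors hp).trans hR))

/-- **Uniformity of the Baker–Wüstholz coefficient on a coefficient fibre.**  For every `R` there is
`K ≥ 0` (namely `C(R+2, 1) · max(log R, 1)^(R+1)`) such that for all `b, c` whose primes are `≤ R`,
the coefficient of Pasten's splitting of `c/b` at threshold `N = 0` satisfies
`C(#I+1, 1) · max(h(ξ₀), 1) · ∏_{p ∈ I} max(log p, 1) ≤ K`: indeed `I ⊆ {0, …, R}` so `#I + 1 ≤ R + 2`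
and `C(·, 1)` is monotone (`bwConstant_mul_pow_le`), `h(ξ₀) ≤ 0` at `N = 0`
(`Pasten.logHeight₁_cofactor_le`), and each of the `≤ R + 1` factors `max(log p, 1)` is
`≤ max(log R, 1)`. [cite: Pasten2024, §4] -/
theorem fibreBaker_coeff_bound (R : ℕ) :
    ∃ K : ℝ, 0 ≤ K ∧ ∀ b c : ℕ, (c * b).primeFactors ⊆ Finset.range (R + 1) →
      bwConstant ((bigPrimes c b 0).card + 1) 1 *
          (max (logHeight₁ (cofactor c b 0)) 1 * ∏ p ∈ bigPrimes c b 0, max (Real.log p) 1) ≤ K := by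
  have hC0 : 0 ≤ bwConstant (R + 2) 1 := (bwConstant_pos (by omega) le_rfl).le
  have hL1 : 1 ≤ max (Real.log R) 1 := le_max_right _ _
  have hL0 : 0 ≤ max (Real.log R) 1 := zero_le_one.trans hL1
  refine ⟨bwConstant (R + 2) 1 * (max (Real.log R) 1) ^ (R + 1), mul_nonneg hC0 (pow_nonneg hL0 _),
    fun b c hS => ?_⟩
  set I := bigPrimes c b 0 with hI
  have hIsub : I ⊆ Finset.range (R + 1) := (bigPrimes_subset c b 0).trans hS
  have hcard : I.card ≤ R + 1 := by simpa using Finset.card_le_card hIsub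
  -- (i) the constant `C(#I + 1, 1) ≤ C(R + 2, 1)`
  have hC : bwConstant (I.card + 1) 1 ≤ bwConstant (R + 2) 1 := by
    have h := bwConstant_mul_pow_le (n' := I.card + 1) (n := R + 2) (d := 1)
      (by omega) (by omega) le_rfl
    simpa using h
  -- (ii) at threshold `N = 0` the cofactor has height `0`
  have hH : max (logHeight₁ (cofactor c b 0)) 1 ≤ 1 := by
    refine max_le ?_ le_rfl
    have h := logHeight₁_cofactor_le c b 0
    simp only [Nat.cast_zero, zero_mul] at h
    linarith
  -- (iii) the big primes: `≤ R + 1` factors, each `≤ max (log R) 1`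
  have hP : ∏ p ∈ I, max (Real.log p) 1 ≤ (max (Real.log R) 1) ^ (R + 1) := by
    calc ∏ p ∈ I, max (Real.log p) 1 ≤ ∏ _p ∈ I, max (Real.log R) 1 := by
          refine Finset.prod_le_prod (fun p _ => zero_le_one.trans (le_max_right _ _))
            fun p hp => max_le_max ?_ le_rfl
          have hpR : p ≤ R := Nat.lt_succ_iff.mp (Finset.mem_range.mp (hIsub hp))
          have hp0 : 0 < p := (prime_of_mem_bigPrimes hp).pos
          exact Real.log_le_log (by exact_mod_cast hp0) (by exact_mod_cast hpR)
      _ = (max (Real.log R) 1) ^ I.card := Finset.prod_const _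
      _ ≤ (max (Real.log R) 1) ^ (R + 1) := pow_le_pow_right₀ hL1 hcard
  have hH0 : 0 ≤ max (logHeight₁ (cofactor c b 0)) 1 := zero_le_one.trans (le_max_right _ _)
  have hP0 : 0 ≤ ∏ p ∈ I, max (Real.log p) 1 :=
    Finset.prod_nonneg fun p _ => zero_le_one.trans (le_max_right _ _)
  calc bwConstant (I.card + 1) 1 *
        (max (logHeight₁ (cofactor c b 0)) 1 * ∏ p ∈ I, max (Real.log p) 1)
      ≤ bwConstant (R + 2) 1 * (1 * (max (Real.log R) 1) ^ (R + 1)) :=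
        mul_le_mul hC (mul_le_mul hH hP hP0 zero_le_one) (mul_nonneg hH0 hP0) hC0
    _ = bwConstant (R + 2) 1 * (max (Real.log R) 1) ^ (R + 1) := by rw [one_mul]

/-! ### The stub -/

/-- **Stub `stub_fibreBaker` (the Baker stratum of the T core of line `Sketch`).**  Assume the
theorem of Baker–Wüstholz over `ℚ` (the cited named fact `baker_wustholz ℚ`).  Then for every `R` and
every `δ > 0` there is `C = C(R, δ) > 0` such that every abc triple `(a, b, c)` on the coefficient
fibre `rad(bc) ≤ R` satisfies `c ≤ C · a^(1+δ)` — at every depth, with no restriction on the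
exponents of the primes of `b` and `c`.  Proof: Baker–Wüstholz on Pasten's splitting of `c/b` at
threshold `0` (`Literature.Barriers.ABC.neg_log_abs_one_sub_div_le_of_bakerWustholz`) gives
`log b − log a = −log|1 − c/b| ≤ 1 + K_R (1 + log(log(cb)/log 2))` uniformly on the fibre
(`fibreBaker_coeff_bound`), and the absorption lemma `fibreBaker_absorb` turns this into
`c ≤ C · a^(1+δ)`. [cite: BakerWustholz2007, Thm 7.1] [cite: Pasten2024, §4] -/
theorem stub_fibreBaker :
    Literature.NumberTheory.DiophantineGeometry.baker_wustholz ℚ →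
    ∀ R : ℕ, ∀ δ : ℝ, 0 < δ → ∃ C : ℝ, 0 < C ∧ ∀ a b c : ℕ,
      Literature.NumberTheory.DiophantineGeometry.IsABCTriple a b c →
      UniqueFactorizationMonoid.radical (b * c) ≤ R →
      (c : ℝ) ≤ C * (a : ℝ) ^ (1 + δ) := by
  intro hBW R δ hδ
  obtain ⟨K, hK0, hKle⟩ := fibreBaker_coeff_bound R
  obtain ⟨M, hM, hMabs⟩ := fibreBaker_absorb hK0 hδ
  refine ⟨M, hM, fun a b c habc hR => ?_⟩
  obtain ⟨ha, hb, hsum, hcop⟩ := habc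
  -- `c, b` coprime with `cb ≥ 2`: Baker–Wüstholz on the splitting of `c/b` at threshold `0`
  have hcb : Nat.Coprime c b := by
    rw [← hsum]; exact Nat.coprime_add_self_left.mpr hcop
  have h1 : 1 < c * b :=
    calc 1 < c := by omega
      _ ≤ c * b := Nat.le_mul_of_pos_right c hb
  have hBWcb := Literature.Barriers.ABC.neg_log_abs_one_sub_div_le_of_bakerWustholz
    (u := c) (v := b) hBW (by omega) hb.ne' hcb h1 0
  have hcoef := hKle b c (fibreBaker_primeFactors_subset hR)
  -- the left side is `log b - log a`
  have ha0 : (0 : ℝ) < a := by exact_mod_cast ha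
  have hb0 : (0 : ℝ) < b := by exact_mod_cast hb
  have hceq : (c : ℝ) = a + b := by exact_mod_cast hsum.symm
  have hL : -Real.log |1 - (c : ℝ) / b| = Real.log b - Real.log a := by
    have hsub : (1 : ℝ) - (c : ℝ) / b = -((a : ℝ) / b) := by
      rw [hceq, add_div, div_self hb0.ne']; ring
    rw [hsub, abs_neg, abs_of_pos (div_pos ha0 hb0), Real.log_div ha0.ne' hb0.ne']
    ring
  -- the last factor of the Baker–Wüstholz bound is `≥ 1 ≥ 0`
  have hlog2 : 0 < Real.log 2 := Real.log_pos (by norm_num)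
  have hT : 0 ≤ 1 + Real.log (Real.log ((c : ℝ) * b) / Real.log 2) := by
    have hcb2 : (2 : ℝ) ≤ (c : ℝ) * b := by exact_mod_cast h1
    have hQ1 : 1 ≤ Real.log ((c : ℝ) * b) / Real.log 2 := by
      rw [le_div_iff₀ hlog2, one_mul]; exact Real.log_le_log two_pos hcb2
    have := Real.log_nonneg hQ1
    linarith
  have hmain : Real.log b - Real.log a ≤
      1 + K * (1 + Real.log (Real.log ((c : ℝ) * b) / Real.log 2)) := by
    rw [← hL]
    have := mul_le_mul_of_nonneg_right hcoef hT
    linarith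
  exact hMabs (a : ℝ) (b : ℝ) (c : ℝ) (by exact_mod_cast ha) (by exact_mod_cast hb) hceq.symm hmain

end Summit.ABC.ABC.Theorems.DepthCountedABC
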